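import Literature.Computability.Complexity.ProofComplexity
import Literature.Computability.MetaComplexity.FregeProofs
import Literature.Computability.MetaComplexity.FregeTranslation
import Literature.Computability.MetaComplexity.TextbookFregeCompleteness
import HarnessLib

/-!
# Proof complexity: discharges of `isPolyBounded_iff_of_isFrege` (Cook–Reckhow 1979, Cor. 2.4), `efNotPolyBounded_iff_textbookFrege` (ibid., §4) and `frege_pSimulates` (ibid., Thm. 2.3 / Cor. 2.4)

Sibling proof file of `ProofComplexity.lean` (D-0014: named facts `def X : Prop` are
discharged as `theorem X_holds : X`; users' hypotheses `(h : X)` are then fed `X_holds`). It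
discharges

* `Literature.Computability.Complexity.isPolyBounded_iff_of_isFrege_holds` — for Frege systems `F₁`, `F₂` over the fixed
  basis of `PropForm` (`¬, ∧, ∨`, constants), `F₁` is polynomially bounded iff `F₂` is.
* `Literature.Computability.Complexity.efNotPolyBounded_iff_textbookFrege_holds` — `EFNotPolyBounded` (no Frege system has
  polynomially bounded extended Frege) iff extended Frege over the concrete system
  `textbookFrege` is not polynomially bounded (second part of this file, which uses the
  completeness of `textbookFrege`, `isFrege_textbookFrege_holds` of
  `TextbookFregeCompleteness.lean`).
* `Literature.Computability.Complexity.frege_pSimulates_holds` (**pnp.S30(b)**, third part of this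
  file) — any two Frege systems over the fixed basis p-simulate each other: the rule-by-rule
  translation `FregeTransl.translForms` of `MetaComplexity/FregeTranslation.lean`, proved
  polynomial-time there (`FregeTransl.polyTimeComputable_translForms`), sends `F₂`-proofs to
  `F₁`-proofs (`FregeSystem.translForms_relaxed`,
  `FregeSystem.pSimulates_of_isImplicationallyComplete`).

Source. S. A. Cook, R. A. Reckhow, *The relative efficiency of propositional proof systems*,
J. Symbolic Logic 44 (1979) 36–50, §2:

* **Theorem 2.3.** "For any two Frege systems `𝓕₁` and `𝓕₂` over `κ` there is a function `f`
  in `𝓛` and constant `c` such that for all formulas `A₁, …, Aₙ, B` and derivations `π`, if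
  `A₁, …, Aₙ ⊢^π_{𝓕₁} B` then `A₁, …, Aₙ ⊢^{f(π)}_{𝓕₂} B`, and `λ(f(π)) ≤ c λ(π)` and
  `ρ(f(π)) ≤ c ρ(π)`." (`λ` = number of lines, `ρ` = maximal number of atom occurrences in a
  line.)
* **Corollary 2.4.** "Any two Frege systems over `κ` p-simulate each other. Hence one Frege
  system over `κ` is polynomially bounded iff all Frege systems over `κ` are."
* **Lemma 2.5.** "If `π` is a derivation of `A` from `B₁, …, B_k` in a Frege system `𝓕`, then
  `σ(π)` is a derivation of `σA` from `σB₁, …, σB_k` in `𝓕`, for any substitution `σ`."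
* Proof of 2.3 (§2, after Lemma 2.5): "For each rule `R = (C₁, …, C_m)/D` in `𝓕₁`, let `π_R` be a
  derivation of `D` from `C₁, …, C_m` in `𝓕₂`. … if `B_i` follows from earlier `B_j`'s by the
  `𝓕₁`-rule `R_i` and substitution `σ_i`, simply replace `B_i` by the derivation `σ_i(π_{R_i})`
  (with hypotheses deleted)."

Secondary: J. Krajíček, *Bounded arithmetic, propositional logic, and complexity theory*
(CUP 1995), p. 49, Thm. 4.4.13 (Reckhow's theorem; the common-language case "is rather easy"),
pp. 43–44, Def. 4.4.1–4.4.2.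

## What is proved, and why no machine model is needed

The named fact `isPolyBounded_iff_of_isFrege` is the *second* sentence of Cor. 2.4 restricted
to the one connective basis of the prelude. `FregeSystem.IsPolyBounded` (`Frege.lean`) is a
pure size statement (every tautology `φ` has a proof `π` with `proofSize π ≤ p(φ.size)`), so
the discharge goes through the *size part* of Theorem 2.3 — the rule-by-rule translation and
its bounds — and never needs the polynomial-time computability of `f` (which the p-simulation
`frege_pSimulates`, pnp.S30(b), does need: third part of this file, on top of
`FregeTranslation.lean`). Concretely we prove
(`FregeSystem.exists_translation`): if `F₁` is implicationally complete and `F₂` is sound,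
there is a constant `B` (the maximal size of the chosen rule derivations `π_R`) such that every
`F₂`-derivation `π` of `φ` from `Γ` yields an `F₁`-derivation of `φ` from `Γ` of size at most
`proofSize π · (B · proofSize π + proofSize π) + proofSize π`; hence
(`FregeSystem.IsPolyBounded.of_isImplicationallyComplete`) polynomial boundedness transfers
with the polynomial `p · (B p + p) + p`, and the `↔` follows by symmetry.

Two points the printed proof leaves implicit are made explicit here:

1. *Extraneous metavariables.* The derivation `π_R` of `D` from `C₁, …, C_m` given by
   implicational completeness may contain variables not occurring in the rule `R`; the
   substitution `σ_i` is modified to send those to the constant `⊤` (`const true`), which does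
   not affect the premise and conclusion instances (`PropForm.subst_congr`) and keeps every
   substituted line of size `≤ |line| · proofSize π` (`PropForm.size_subst_le`, since every
   `σ_i x` with `x` in `R` is a subformula of a line of `π`, `PropForm.size_apply_le_size_subst`).
2. *"With hypotheses deleted".* Rather than deleting the hypothesis lines of each block
   `σ_i(π_{R_i})` (they coincide with earlier lines `B_j`), we first concatenate the blocks into
   a sequence in which every line is a hypothesis, is inferred from earlier lines, or *repeats*
   an earlier line (`exists_translation_aux`), and then prune repetitions in one pass
   (`exists_isDerivation_of_relaxed`: keep the first occurrence of each line; inferences only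
   depend on the *set* of earlier lines, `IsInferred.mono`), finally cutting the derivation
   right after the first occurrence of `φ` (`IsDerivation.take`, `IsDerivation.snoc`).

## Proof architecture

1. `PropForm.size_subst_le`, `PropForm.size_apply_le_size_subst`: size algebra of
   substitution.
2. `FregeSystem.IsInferred.mono`, `IsDerivation.map_subst` (Lemma 2.5 with hypotheses),
   `IsDerivation.take`, `IsDerivation.snoc`, `isDerivation_singleton`, size bookkeeping
   (`proofSize_append`, `size_le_proofSize`, `length_le_proofSize`, `proofSize_take_le`,
   `proofSize_map_subst_le`).
3. `exists_isDerivation_of_relaxed` (pruning repetitions), `relaxed_append` (appending a block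
   whose hypotheses occur earlier).
4. `exists_ruleDerivations` (the table `R ↦ π_R` with a uniform size bound `B`),
   `exists_block` (one translated line: `σ'(π_R)`), `exists_translation_aux` (all lines),
   `exists_translation` (Theorem 2.3, size form).
5. `IsPolyBounded.of_isImplicationallyComplete`, `Literature.Computability.Complexity.isPolyBounded_iff_of_isFrege_holds`.

## Extended Frege (second part)

Cook–Reckhow 1979, §4: Def. 4.1 ("An extended Frege system … consists of a Frege system `𝓕`
over `κ` together with the extension rule which allows formulas of the form `P ≡ A` to be added
to a derivation, where … `P` must not occur in `A`, in any lines preceding `P ≡ A`, or in any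
hypotheses to the derivation. `P` can occur in later lines, but not in the last line."),
Thm. 4.5 and Cor. 4.7 ("A given extended Frege system is polynomially bounded if and only if
all extended Frege systems over all connective sets are polynomially bounded."). Over one
connective basis (the setting of `Frege.lean`) the corollary follows from the translation of
Thm. 2.3 applied verbatim to extended-Frege proofs, copying the extension axioms (Krajíček
1995, §4.5, p. 56: "any two extended Frege systems polynomially simulate each other"); the
printed proof of Thm. 4.5 for different bases (Lemmas 4.8–4.11) is not needed. The one point
to check is that a copied extension axiom `p ↔ ψ` stays fresh: the block `σ'(π_R)` replacing a
line only contains variables of that line and of its premises (`exists_block_vars`, because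
the extraneous metavariables of `π_R` are sent to `⊤`), so every variable of the translated
prefix occurs in the original prefix (`exists_translationEF_aux`), and freshness only depends
on the set of variables of the earlier lines (`IsExtensionAxiom.of_vars`).

6. `PropForm.mem_vars_subst`; `IsExtensionAxiom.of_vars`, `isEFDerivation_nil`,
   `IsEFDerivation.snoc`, `IsEFDerivation.take`, `exists_isEFDerivation_of_relaxed` (pruning),
   `relaxedEF_append`, `relaxedEF_append_ext`.
7. `exists_block_vars`, `exists_translationEF_aux`, `exists_translationEF` (size form of the
   translation for extended Frege), `IsEFPolyBounded.of_isImplicationallyComplete`,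
   `Literature.Computability.Complexity.efNotPolyBounded_iff_textbookFrege_holds`.

## The p-simulation (third part)

8. `FregeSystem.isDerivation_empty_of_relaxed` (a sequence of inferred-or-repeated lines from no
   hypotheses is a derivation), `FregeSystem.translForms_relaxed` (the translation
   `FregeTransl.translForms D F₂.rules` of an `F₂`-derivation from `∅` is such a sequence,
   contains every original line and ends with the original last line — Thm. 2.3 with Lemma 2.5,
   using `FregeTransl.lineForms_of_inferred` and `relaxed_append`),
   `FregeSystem.pSimulates_of_isImplicationallyComplete` (with the table `D` from
   `exists_ruleDerivations` and `FregeTransl.polyTimeComputable_translForms`),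
   `Literature.Computability.Complexity.frege_pSimulates_holds`.

## References

* S. A. Cook, R. A. Reckhow, *The relative efficiency of propositional proof systems*,
  J. Symbolic Logic 44 (1979) 36–50: §2, Thm. 2.3, Cor. 2.4, Lemma 2.5 and the proof of 2.3;
  §4, Def. 4.1, Thm. 4.5, Cor. 4.7.
* J. Krajíček, *Bounded arithmetic, propositional logic, and complexity theory*, CUP 1995:
  p. 49, Thm. 4.4.13; pp. 43–44, Def. 4.4.1–4.4.2; §4.5, p. 53, Def. 4.5.2 and p. 56.
-/

namespace Literature.Computability.Complexity.PropForm

/-! ### Size algebra of substitution -/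

universe u

variable {ν : Type u}

/-- If every value of the substitution `τ` has size at most `M ≥ 1`, then
`|φτ| ≤ |φ| · M`. [Cook–Reckhow 1979, §2, proof of Thm. 2.3 (`ρ(f(π)) ≤ c₂ ρ(π)`)]
[cite: CookReckhow1979, Thm. 2.3 (proof)] -/
theorem size_subst_le {τ : ν → PropForm ν} {M : ℕ} (hM : 1 ≤ M) (hτ : ∀ x, (τ x).size ≤ M)
    (φ : PropForm ν) : (φ.subst τ).size ≤ φ.size * M := by
  induction φ with
  | var x => simpa [subst, size] using hτ x
  | const b => simpa [subst, size] using hM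
  | neg φ ih =>
    simp only [subst, size, Nat.add_mul, one_mul]
    omega
  | conj φ ψ ihφ ihψ =>
    simp only [subst, size, Nat.add_mul, one_mul]
    omega
  | disj φ ψ ihφ ihψ =>
    simp only [subst, size, Nat.add_mul, one_mul]
    omega

/-- The value `τ x` at a variable `x` of `φ` is a subformula of `φτ`, hence no larger.
[folklore] -/
theorem size_apply_le_size_subst [DecidableEq ν] (τ : ν → PropForm ν) {φ : PropForm ν} {x : ν}
    (hx : x ∈ φ.vars) : (τ x).size ≤ (φ.subst τ).size := by
  induction φ with
  | var y =>
    simp only [vars, Finset.mem_singleton] at hx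
    subst hx
    simp [subst]
  | const b => simp [vars] at hx
  | neg φ ih =>
    simp only [vars] at hx
    have := ih hx
    simp only [subst, size]
    omega
  | conj φ ψ ihφ ihψ =>
    simp only [vars, Finset.mem_union] at hx
    simp only [subst, size]
    rcases hx with hx | hx
    · have := ihφ hx; omega
    · have := ihψ hx; omega
  | disj φ ψ ihφ ihψ =>
    simp only [vars, Finset.mem_union] at hx
    simp only [subst, size]
    rcases hx with hx | hx
    · have := ihφ hx; omega
    · have := ihψ hx; omega

end Literature.Computability.Complexity.PropForm

namespace Literature.Computability.Complexity

open _root_.Computability Polynomial MetaComplexity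

/-! ### Size bookkeeping for sequences of lines -/

/-- `proofSize` is additive under concatenation. [folklore] -/
theorem proofSize_append (π₁ π₂ : List (PropForm ℕ)) :
    proofSize (π₁ ++ π₂) = proofSize π₁ + proofSize π₂ := by
  simp [proofSize, List.map_append, List.sum_append]

/-- The size of a one-line sequence. [folklore] -/
@[simp] theorem proofSize_singleton (θ : PropForm ℕ) : proofSize [θ] = θ.size := by
  simp [proofSize]

/-- The size of the empty sequence. [folklore] -/
@[simp] theorem proofSize_nil : proofSize ([] : List (PropForm ℕ)) = 0 := by
  simp [proofSize]

/-- A line is no larger than the whole sequence. [folklore] -/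
theorem size_le_proofSize {π : List (PropForm ℕ)} {ψ : PropForm ℕ} (h : ψ ∈ π) :
    ψ.size ≤ proofSize π :=
  List.le_sum_of_mem (List.mem_map_of_mem h)

/-- A sequence has at most `proofSize` lines (every formula has positive size).
[Cook–Reckhow 1979, §1 (length measures)] [folklore] -/
theorem length_le_proofSize (π : List (PropForm ℕ)) : π.length ≤ proofSize π := by
  induction π with
  | nil => simp
  | cons ψ π ih =>
    have := ψ.size_pos
    simp only [proofSize, List.map_cons, List.sum_cons, List.length_cons] at ih ⊢
    omega

/-- A prefix is no larger than the whole sequence. [folklore] -/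
theorem proofSize_take_le (π : List (PropForm ℕ)) (n : ℕ) :
    proofSize (π.take n) ≤ proofSize π := by
  conv_rhs => rw [← List.take_append_drop n π]
  rw [proofSize_append]
  exact Nat.le_add_right _ _

/-- Applying line-wise a substitution with values of size `≤ M` (`M ≥ 1`) multiplies the size
of a sequence by at most `M`. [Cook–Reckhow 1979, §2, proof of Thm. 2.3]
[cite: CookReckhow1979, Thm. 2.3 (proof)] -/
theorem proofSize_map_subst_le {τ : ℕ → PropForm ℕ} {M : ℕ} (hM : 1 ≤ M)
    (hτ : ∀ x, (τ x).size ≤ M) (π : List (PropForm ℕ)) :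
    proofSize (π.map (PropForm.subst τ)) ≤ proofSize π * M := by
  induction π with
  | nil => simp
  | cons ψ π ih =>
    have hψ := PropForm.size_subst_le hM hτ ψ
    simp only [proofSize, List.map_cons, List.map_map, List.sum_cons, Nat.add_mul] at ih ⊢
    omega

section FregeSystem
open Literature.Computability.MetaComplexity (FregeSystem)
open Literature.Computability.MetaComplexity.FregeSystem

variable {F F₁ F₂ : FregeSystem}

/-! ### Derivations: monotonicity, substitution, prefixes, extensions -/

/-- An inference depends on the earlier lines only through their *set*: enlarging the list of
available lines preserves inferences. [Cook–Reckhow 1979, §2 (Def. of derivation)] [folklore] -/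
theorem _root_.Literature.Computability.MetaComplexity.FregeSystem.IsInferred.mono {prev prev' : List (PropForm ℕ)} {θ : PropForm ℕ}
    (h : F.IsInferred prev θ) (hsub : ∀ χ ∈ prev, χ ∈ prev') : F.IsInferred prev' θ := by
  obtain ⟨r, hr, σ, hc, hp⟩ := h
  exact ⟨r, hr, σ, hc, fun p hpp => hsub _ (hp p hpp)⟩

/-- **Lemma 2.5 of Cook–Reckhow** (derivations are closed under substitution): if `π` is a
derivation from `Γ` then `σ(π)` is a derivation from `σ(Γ)`.
[cite: CookReckhow1979, Lemma 2.5] -/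
theorem _root_.Literature.Computability.MetaComplexity.FregeSystem.IsDerivation.map_subst {Γ : Set (PropForm ℕ)} {π : List (PropForm ℕ)}
    (h : F.IsDerivation Γ π) (τ : ℕ → PropForm ℕ) :
    F.IsDerivation (PropForm.subst τ '' Γ) (π.map (PropForm.subst τ)) := by
  intro k hk
  rw [List.length_map] at hk
  rw [List.getElem_map]
  rcases h k hk with hm | hinf
  · exact Or.inl ⟨_, hm, rfl⟩
  · right
    rw [← List.map_take]
    exact hinf.map_subst τ

/-- A prefix of a derivation is a derivation. [Cook–Reckhow 1979, §2] [folklore] -/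
theorem _root_.Literature.Computability.MetaComplexity.FregeSystem.IsDerivation.take {Γ : Set (PropForm ℕ)} {π : List (PropForm ℕ)}
    (h : F.IsDerivation Γ π) (n : ℕ) : F.IsDerivation Γ (π.take n) := by
  intro k hk
  rw [List.length_take] at hk
  have hk' : k < π.length := by omega
  have hkn : k ≤ n := by omega
  rw [List.getElem_take, List.take_take, Nat.min_eq_left hkn]
  exact h k hk'

/-- A derivation may be extended by a hypothesis or by a line inferred from its lines.
[Cook–Reckhow 1979, §2 (Def. of derivation)] [folklore] -/
theorem _root_.Literature.Computability.MetaComplexity.FregeSystem.IsDerivation.snoc {Γ : Set (PropForm ℕ)} {π : List (PropForm ℕ)} {θ : PropForm ℕ}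
    (h : F.IsDerivation Γ π) (hθ : θ ∈ Γ ∨ F.IsInferred π θ) :
    F.IsDerivation Γ (π ++ [θ]) := by
  intro k hk
  rw [List.length_append, List.length_singleton] at hk
  by_cases hk' : k < π.length
  · rw [List.getElem_append_left hk', List.take_append_of_le_length hk'.le]
    exact h k hk'
  · have hkeq : k = π.length := by omega
    have htake : (π ++ [θ]).take k = π := by
      rw [List.take_append_of_le_length (by omega), hkeq, List.take_length]
    rw [List.getElem_concat_length hkeq, htake]
    exact hθ

/-- A single hypothesis is a derivation. [Cook–Reckhow 1979, §2] [folklore] -/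
theorem _root_.Literature.Computability.MetaComplexity.FregeSystem.isDerivation_singleton {Γ : Set (PropForm ℕ)} {θ : PropForm ℕ} (hθ : θ ∈ Γ) :
    F.IsDerivation Γ [θ] := by
  simpa using (isDerivation_nil F Γ).snoc (Or.inl hθ)

/-! ### Pruning repeated lines -/

/-- **Pruning repetitions.** If every line of `L` is a hypothesis, is inferred from earlier
lines, or repeats an earlier line, then keeping only first occurrences gives a derivation from
the same hypotheses with the same set of lines and no larger size. This is the formal content
of "(with hypotheses deleted)" in Cook–Reckhow's proof of Thm. 2.3.
[cite: CookReckhow1979, Thm. 2.3 (proof)] -/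
theorem _root_.Literature.Computability.MetaComplexity.FregeSystem.exists_isDerivation_of_relaxed {Γ : Set (PropForm ℕ)} {L : List (PropForm ℕ)}
    (h : ∀ (k : ℕ) (hk : k < L.length),
      L[k] ∈ Γ ∨ F.IsInferred (L.take k) L[k] ∨ L[k] ∈ L.take k) :
    ∃ L' : List (PropForm ℕ), F.IsDerivation Γ L' ∧ (∀ θ, θ ∈ L' ↔ θ ∈ L) ∧
      proofSize L' ≤ proofSize L := by
  suffices H : ∀ n ≤ L.length, ∃ L' : List (PropForm ℕ), F.IsDerivation Γ L' ∧
      (∀ θ, θ ∈ L' ↔ θ ∈ L.take n) ∧ proofSize L' ≤ proofSize (L.take n) by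
    simpa using H L.length le_rfl
  intro n
  induction n with
  | zero => exact fun _ => ⟨[], isDerivation_nil F Γ, by simp, le_rfl⟩
  | succ n ih =>
    intro hn
    obtain ⟨L', hd, hmem, hsize⟩ := ih (Nat.le_of_succ_le hn)
    have hnlt : n < L.length := hn
    rw [List.take_succ_eq_append_getElem hnlt, proofSize_append, proofSize_singleton]
    by_cases hrep : L[n] ∈ L.take n
    · -- a repetition: drop it
      refine ⟨L', hd, fun θ => ?_, hsize.trans (Nat.le_add_right _ _)⟩
      rw [hmem, List.mem_append, List.mem_singleton]
      exact ⟨Or.inl, fun h' => h'.elim id fun h'' => h'' ▸ hrep⟩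
    · -- a new line: keep it
      have hjust : L[n] ∈ Γ ∨ F.IsInferred L' L[n] := by
        rcases h n hnlt with h₁ | h₂ | h₃
        · exact Or.inl h₁
        · exact Or.inr (h₂.mono fun χ hχ => (hmem χ).2 hχ)
        · exact absurd h₃ hrep
      refine ⟨L' ++ [L[n]], hd.snoc hjust, fun θ => ?_, ?_⟩
      · simp only [List.mem_append, List.mem_singleton, hmem]
      · rw [proofSize_append, proofSize_singleton]
        exact Nat.add_le_add_right hsize _

/-- Appending to a sequence `L₁` (hypotheses, inferred lines, repetitions) a derivation `L₂`
each of whose hypotheses is a hypothesis of `L₁` or occurs in `L₁` gives again such a sequence.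
[cite: CookReckhow1979, Thm. 2.3 (proof)] -/
theorem _root_.Literature.Computability.MetaComplexity.FregeSystem.relaxed_append {Γ Λ : Set (PropForm ℕ)} {L₁ L₂ : List (PropForm ℕ)}
    (h₁ : ∀ (k : ℕ) (hk : k < L₁.length),
      L₁[k] ∈ Γ ∨ F.IsInferred (L₁.take k) L₁[k] ∨ L₁[k] ∈ L₁.take k)
    (h₂ : F.IsDerivation Λ L₂) (hΛ : ∀ θ ∈ Λ, θ ∈ Γ ∨ θ ∈ L₁) :
    ∀ (k : ℕ) (hk : k < (L₁ ++ L₂).length),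
      (L₁ ++ L₂)[k] ∈ Γ ∨ F.IsInferred ((L₁ ++ L₂).take k) (L₁ ++ L₂)[k] ∨
        (L₁ ++ L₂)[k] ∈ (L₁ ++ L₂).take k := by
  intro k hk
  by_cases hk₁ : k < L₁.length
  · rw [List.getElem_append_left hk₁, List.take_append_of_le_length hk₁.le]
    exact h₁ k hk₁
  · have hle : L₁.length ≤ k := Nat.le_of_not_lt hk₁
    have hk₂ : k - L₁.length < L₂.length := by rw [List.length_append] at hk; omega
    rw [List.getElem_append_right hle, List.take_append, List.take_of_length_le hle]
    rcases h₂ (k - L₁.length) hk₂ with hm | hinf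
    · rcases hΛ _ hm with hΓ | hL₁
      · exact Or.inl hΓ
      · exact Or.inr (Or.inr (List.mem_append_left _ hL₁))
    · exact Or.inr (Or.inl (hinf.mono fun χ hχ => List.mem_append_right _ hχ))

/-! ### The rule-by-rule translation (Cook–Reckhow 1979, Thm. 2.3) -/

/-- The table `R ↦ π_R`: an implicationally complete system `F₁` derives the conclusion of every
sound rule from its premises; over a finite list of rules the derivations have a common size
bound `B`. [cite: CookReckhow1979, Thm. 2.3 (proof)] -/
theorem _root_.Literature.Computability.MetaComplexity.FregeSystem.exists_ruleDerivations (h₁ : F₁.IsImplicationallyComplete) :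
    ∀ rs : List FregeRule, (∀ r ∈ rs, r.IsSound) →
      ∃ B : ℕ, ∀ r ∈ rs, ∃ D : List (PropForm ℕ),
        F₁.IsDerivation {p | p ∈ r.premises} D ∧ D.getLast? = some r.conclusion ∧
          proofSize D ≤ B
  | [], _ => ⟨0, by simp⟩
  | r :: rs, hs => by
    obtain ⟨B, hB⟩ := exists_ruleDerivations h₁ rs fun r' hr' => hs r' (List.mem_cons_of_mem _ hr')
    obtain ⟨D, hD, hlast⟩ := h₁ r.premises.toFinset r.conclusion fun σ hσ =>
      hs r List.mem_cons_self σ fun p hp => hσ p (List.mem_toFinset.2 hp)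
    refine ⟨max (proofSize D) B, fun r' hr' => ?_⟩
    rcases List.mem_cons.1 hr' with rfl | hr'
    · refine ⟨D, hD.mono fun p hp => ?_, hlast, le_max_left _ _⟩
      simpa using hp
    · obtain ⟨D', hD', hlast', hB'⟩ := hB r' hr'
      exact ⟨D', hD', hlast', hB'.trans (le_max_right _ _)⟩

/-- **One translated line.** If `θ ∈ π` is inferred in `F₂` from lines `prev ⊆ π` by the rule
`R` and substitution `σ`, then `σ'(π_R)` — with `σ'` equal to `σ` on the variables of `R` and
`⊤` elsewhere — is an `F₁`-derivation of (a sequence containing) `θ` from `prev`, of size at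
most `B · proofSize π`. [cite: CookReckhow1979, Thm. 2.3 (proof)]
[cite: CookReckhow1979, Lemma 2.5] -/
theorem _root_.Literature.Computability.MetaComplexity.FregeSystem.exists_block {B : ℕ}
    (hB : ∀ r ∈ F₂.rules, ∃ D : List (PropForm ℕ),
      F₁.IsDerivation {p | p ∈ r.premises} D ∧ D.getLast? = some r.conclusion ∧
        proofSize D ≤ B)
    {π prev : List (PropForm ℕ)} {θ : PropForm ℕ}
    (hprev : ∀ χ ∈ prev, χ ∈ π) (hθπ : θ ∈ π) (hinf : F₂.IsInferred prev θ) :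
    ∃ blk : List (PropForm ℕ),
      F₁.IsDerivation {χ | χ ∈ prev} blk ∧ θ ∈ blk ∧ proofSize blk ≤ B * proofSize π := by
  classical
  obtain ⟨r, hr, σ, hc, hp⟩ := hinf
  obtain ⟨D, hD, hlast, hDB⟩ := hB r hr
  -- the (meta)variables of the rule `r`
  set V : Finset ℕ := r.conclusion.vars ∪ (r.premises.map PropForm.vars).foldr (· ∪ ·) ∅
    with hV
  have hVmem : ∀ x, x ∈ V ↔ x ∈ r.conclusion.vars ∨ ∃ p ∈ r.premises, x ∈ p.vars := by
    intro x
    rw [hV, Finset.mem_union, mem_foldr_union_vars]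
  -- `σ'`: `σ` on the variables of `r`, `⊤` on the extraneous variables of `D`
  set σ' : ℕ → PropForm ℕ := fun x => if x ∈ V then σ x else PropForm.const true with hσ'
  have hagree : ∀ q : PropForm ℕ, (∀ x ∈ q.vars, x ∈ V) → q.subst σ' = q.subst σ := by
    intro q hq
    exact PropForm.subst_congr fun x hx => by simp [hσ', hq x hx]
  have hconc : r.conclusion.subst σ' = θ := by
    rw [hagree _ fun x hx => (hVmem x).2 (Or.inl hx), hc]
  have hprem : ∀ p ∈ r.premises, p.subst σ' = p.subst σ := fun p hpm =>
    hagree _ fun x hx => (hVmem x).2 (Or.inr ⟨p, hpm, hx⟩)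
  -- every value of `σ'` is a subformula of a line of `π`, or `⊤`
  have hM1 : 1 ≤ proofSize π := θ.size_pos.trans_le (size_le_proofSize hθπ)
  have hσ'M : ∀ x, (σ' x).size ≤ proofSize π := by
    intro x
    by_cases hx : x ∈ V
    · have hσx : σ' x = σ x := by simp [hσ', hx]
      rw [hσx]
      rcases (hVmem x).1 hx with hxc | ⟨p, hpm, hxp⟩
      · calc (σ x).size ≤ (r.conclusion.subst σ).size := PropForm.size_apply_le_size_subst σ hxc
          _ ≤ proofSize π := by rw [hc]; exact size_le_proofSize hθπ
      · calc (σ x).size ≤ (p.subst σ).size := PropForm.size_apply_le_size_subst σ hxp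
          _ ≤ proofSize π := size_le_proofSize (hprev _ (hp p hpm))
    · have hσx : σ' x = PropForm.const true := by simp [hσ', hx]
      rw [hσx]
      simpa [PropForm.size] using hM1
  refine ⟨D.map (PropForm.subst σ'), (hD.map_subst σ').mono ?_, ?_, ?_⟩
  · rintro _ ⟨p, hpm, rfl⟩
    show p.subst σ' ∈ prev
    rw [hprem p hpm]
    exact hp p hpm
  · rw [← hconc]
    exact List.mem_map_of_mem (List.mem_of_getLast? hlast)
  · calc proofSize (D.map (PropForm.subst σ'))
        ≤ proofSize D * proofSize π := proofSize_map_subst_le hM1 hσ'M D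
      _ ≤ B * proofSize π := Nat.mul_le_mul_right _ hDB

/-- **All lines translated.** Concatenating the blocks of the first `n` lines of an
`F₂`-derivation `π` from `Γ` (a hypothesis line is its own block) gives a sequence of size at
most `n · (B · proofSize π + proofSize π)` containing these `n` lines, in which every line is
a hypothesis, is `F₁`-inferred from earlier lines, or repeats an earlier line.
[cite: CookReckhow1979, Thm. 2.3 (proof)] -/
theorem _root_.Literature.Computability.MetaComplexity.FregeSystem.exists_translation_aux {B : ℕ}
    (hB : ∀ r ∈ F₂.rules, ∃ D : List (PropForm ℕ),
      F₁.IsDerivation {p | p ∈ r.premises} D ∧ D.getLast? = some r.conclusion ∧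
        proofSize D ≤ B)
    {Γ : Set (PropForm ℕ)} {π : List (PropForm ℕ)} (hπ : F₂.IsDerivation Γ π) :
    ∀ n ≤ π.length, ∃ L : List (PropForm ℕ),
      (∀ (k : ℕ) (hk : k < L.length),
        L[k] ∈ Γ ∨ F₁.IsInferred (L.take k) L[k] ∨ L[k] ∈ L.take k) ∧
      (∀ θ ∈ π.take n, θ ∈ L) ∧ proofSize L ≤ n * (B * proofSize π + proofSize π)
  | 0, _ => ⟨[], fun k hk => absurd hk (Nat.not_lt_zero k), by simp, by simp⟩
  | n + 1, hn => by
    obtain ⟨L, hL, hmem, hsize⟩ := exists_translation_aux hB hπ n (Nat.le_of_succ_le hn)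
    have hnlt : n < π.length := hn
    have hθπ : π[n] ∈ π := List.getElem_mem hnlt
    rw [List.take_succ_eq_append_getElem hnlt]
    -- the block for line `n`
    obtain ⟨blk, hblk, hmemblk, hsizeblk⟩ : ∃ blk : List (PropForm ℕ),
        (∀ (k : ℕ) (hk : k < (L ++ blk).length),
          (L ++ blk)[k] ∈ Γ ∨ F₁.IsInferred ((L ++ blk).take k) (L ++ blk)[k] ∨
            (L ++ blk)[k] ∈ (L ++ blk).take k) ∧
        π[n] ∈ blk ∧ proofSize blk ≤ B * proofSize π + proofSize π := by
      rcases hπ n hnlt with hΓ | hinf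
      · -- a hypothesis line is kept
        exact ⟨[π[n]], relaxed_append hL (isDerivation_singleton hΓ) fun θ hθ => Or.inl hθ,
          List.mem_singleton_self _,
          by simpa using (size_le_proofSize hθπ).trans (Nat.le_add_left _ _)⟩
      · -- an inferred line is replaced by its block
        obtain ⟨blk, hd, hmemblk, hsz⟩ :=
          exists_block hB (fun χ hχ => List.mem_of_mem_take hχ) hθπ hinf
        exact ⟨blk, relaxed_append hL hd fun θ hθ => Or.inr (hmem θ hθ), hmemblk,
          hsz.trans (Nat.le_add_right _ _)⟩
    refine ⟨L ++ blk, hblk, fun θ hθ => ?_, ?_⟩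
    · rw [List.mem_append, List.mem_singleton] at hθ
      rcases hθ with hθ | rfl
      · exact List.mem_append_left _ (hmem θ hθ)
      · exact List.mem_append_right _ hmemblk
    · rw [proofSize_append, Nat.succ_mul]
      exact Nat.add_le_add hsize hsizeblk

/-- **Cook–Reckhow 1979, Theorem 2.3 (size form).** If `F₁` is implicationally complete and
the rules of `F₂` are sound, there is a constant `B` such that every `F₂`-derivation `π` of
`φ` from `Γ` can be replaced by an `F₁`-derivation of `φ` from `Γ` of size at most
`proofSize π · (B · proofSize π + proofSize π) + proofSize π`. (The printed theorem also
asserts that the translation is polynomial-time computable and bounds lines and line width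
separately, `λ(f(π)) ≤ c λ(π)`, `ρ(f(π)) ≤ c ρ(π)`; only the resulting polynomial size bound
is recorded here.) [cite: CookReckhow1979, Thm. 2.3] -/
theorem _root_.Literature.Computability.MetaComplexity.FregeSystem.exists_translation (h₁ : F₁.IsImplicationallyComplete) (h₂ : F₂.IsSound) :
    ∃ B : ℕ, ∀ (Γ : Set (PropForm ℕ)) (π : List (PropForm ℕ)) (φ : PropForm ℕ),
      F₂.IsDerivation Γ π → π.getLast? = some φ →
      ∃ π' : List (PropForm ℕ), F₁.IsDerivation Γ π' ∧ π'.getLast? = some φ ∧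
        proofSize π' ≤ proofSize π * (B * proofSize π + proofSize π) + proofSize π := by
  obtain ⟨B, hB⟩ := exists_ruleDerivations h₁ F₂.rules h₂
  refine ⟨B, fun Γ π φ hπ hlast => ?_⟩
  obtain ⟨L, hL, hmem, hsize⟩ := exists_translation_aux hB hπ π.length le_rfl
  rw [List.take_length] at hmem
  obtain ⟨L', hL', hmem', hsize'⟩ := exists_isDerivation_of_relaxed hL
  have hφπ : φ ∈ π := List.mem_of_getLast? hlast
  obtain ⟨i, hi, hiφ⟩ := List.getElem_of_mem ((hmem' φ).2 (hmem φ hφπ))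
  refine ⟨L'.take i ++ [φ], (hL'.take i).snoc ?_, by simp, ?_⟩
  · have := hL' i hi
    rwa [hiφ] at this
  · rw [proofSize_append, proofSize_singleton]
    calc proofSize (L'.take i) + φ.size
        ≤ proofSize L + proofSize π :=
          Nat.add_le_add ((proofSize_take_le L' i).trans hsize') (size_le_proofSize hφπ)
      _ ≤ π.length * (B * proofSize π + proofSize π) + proofSize π :=
          Nat.add_le_add_right hsize _
      _ ≤ proofSize π * (B * proofSize π + proofSize π) + proofSize π :=
          Nat.add_le_add_right (Nat.mul_le_mul_right _ (length_le_proofSize π)) _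

/-- **Transfer of polynomial boundedness** (the size content of Cook–Reckhow's Cor. 2.4): if
`F₁` is implicationally complete, `F₂` is sound and every tautology `φ` has an `F₂`-proof of
size `≤ p(|φ|)`, then it has an `F₁`-proof of size `≤ (p · (B p + p) + p)(|φ|)`.
[cite: CookReckhow1979, Cor. 2.4] -/
theorem _root_.Literature.Computability.MetaComplexity.FregeSystem.IsPolyBounded.of_isImplicationallyComplete (h₁ : F₁.IsImplicationallyComplete)
    (h₂ : F₂.IsSound) (h : F₂.IsPolyBounded) : F₁.IsPolyBounded := by
  obtain ⟨B, hB⟩ := exists_translation h₁ h₂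
  obtain ⟨p, hp⟩ := h
  refine ⟨p * (C B * p + p) + p, fun φ hφ => ?_⟩
  obtain ⟨π, hπ, hsize⟩ := hp φ hφ
  obtain ⟨π', hπ', hlast', hsize'⟩ := hB ∅ π φ hπ.1 hπ.2
  refine ⟨π', ⟨hπ', hlast'⟩, hsize'.trans ?_⟩
  simp only [eval_add, eval_mul, eval_C]
  exact Nat.add_le_add
    (Nat.mul_le_mul hsize (Nat.add_le_add (Nat.mul_le_mul_left _ hsize) hsize)) hsize

end FregeSystem

end Literature.Computability.Complexity

namespace Literature.Computability.Complexity

open MetaComplexity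

/-- **Discharge of `isPolyBounded_iff_of_isFrege`** (Cook–Reckhow 1979, §2, Cor. 2.4:
"Any two Frege systems over `κ` p-simulate each other. Hence one Frege system over `κ` is
polynomially bounded iff all Frege systems over `κ` are."), for Frege systems over the fixed
basis of `PropForm`: both directions are
`FregeSystem.IsPolyBounded.of_isImplicationallyComplete`, which uses the completeness of the
simulating system and the soundness of the simulated one. [cite: CookReckhow1979, Cor. 2.4]
[cite: Krajicek1995, Thm 4.4.13] -/
theorem isPolyBounded_iff_of_isFrege_holds : isPolyBounded_iff_of_isFrege := by
  intro F₁ F₂ h₁ h₂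
  exact ⟨fun h => FregeSystem.IsPolyBounded.of_isImplicationallyComplete h₂.2 h₁.1 h,
    fun h => FregeSystem.IsPolyBounded.of_isImplicationallyComplete h₁.2 h₂.1 h⟩

end Literature.Computability.Complexity

/-! ## Extended Frege: the rule-by-rule translation (Cook–Reckhow 1979, §4 with Thm. 2.3) -/

namespace Literature.Computability.Complexity.PropForm

universe u

variable {ν : Type u}

/-- The variables of `φσ` are the variables of the values `σ x` at the variables `x` of `φ`.
[folklore] -/
theorem mem_vars_subst [DecidableEq ν] (σ : ν → PropForm ν) (φ : PropForm ν) (v : ν) :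
    v ∈ (φ.subst σ).vars ↔ ∃ x ∈ φ.vars, v ∈ (σ x).vars := by
  induction φ with
  | var x => simp [subst, vars]
  | const b => simp [subst, vars]
  | neg φ ih => simpa [subst, vars] using ih
  | conj φ ψ ihφ ihψ =>
    simp only [subst, vars, Finset.mem_union, ihφ, ihψ]
    constructor
    · rintro (⟨x, hx, hv⟩ | ⟨x, hx, hv⟩)
      · exact ⟨x, Or.inl hx, hv⟩
      · exact ⟨x, Or.inr hx, hv⟩
    · rintro ⟨x, hx | hx, hv⟩
      · exact Or.inl ⟨x, hx, hv⟩
      · exact Or.inr ⟨x, hx, hv⟩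
  | disj φ ψ ihφ ihψ =>
    simp only [subst, vars, Finset.mem_union, ihφ, ihψ]
    constructor
    · rintro (⟨x, hx, hv⟩ | ⟨x, hx, hv⟩)
      · exact ⟨x, Or.inl hx, hv⟩
      · exact ⟨x, Or.inr hx, hv⟩
    · rintro ⟨x, hx | hx, hv⟩
      · exact Or.inl ⟨x, hx, hv⟩
      · exact Or.inr ⟨x, hx, hv⟩

end Literature.Computability.Complexity.PropForm

namespace Literature.Computability.Complexity

open _root_.Computability Polynomial MetaComplexity

section FregeSystem
open Literature.Computability.MetaComplexity (FregeSystem)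
open Literature.Computability.MetaComplexity.FregeSystem

variable {F F₁ F₂ : FregeSystem}

/-- The freshness condition of an extension axiom only depends on the variables of the earlier
lines: if every variable of a line of `prev'` already occurs in a line of `prev`, an extension
axiom after `prev` is an extension axiom after `prev'`. [Cook–Reckhow 1979, §4, Def. 4.1
("`P` must not occur in `A`, in any lines preceding `P ≡ A`, …")] [cite: CookReckhow1979, Def. 4.1] -/
theorem _root_.Literature.Computability.MetaComplexity.FregeSystem.IsExtensionAxiom.of_vars {φ θ : PropForm ℕ} {prev prev' : List (PropForm ℕ)}
    (h : IsExtensionAxiom φ prev θ)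
    (hsub : ∀ χ ∈ prev', ∀ v ∈ χ.vars, ∃ χ₀ ∈ prev, v ∈ χ₀.vars) :
    IsExtensionAxiom φ prev' θ := by
  obtain ⟨p, ψ, hθ, hpψ, hpφ, hprev⟩ := h
  refine ⟨p, ψ, hθ, hpψ, hpφ, fun χ hχ hp => ?_⟩
  obtain ⟨χ₀, hχ₀, hp₀⟩ := hsub χ hχ p hp
  exact hprev χ₀ hχ₀ hp₀

/-! ### Extended-Frege derivations: prefixes, extensions, pruning -/

/-- The empty sequence is an extended-Frege derivation. [Cook–Reckhow 1979, §4] [folklore] -/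
theorem _root_.Literature.Computability.MetaComplexity.FregeSystem.isEFDerivation_nil (F : FregeSystem) (φ : PropForm ℕ) : F.IsEFDerivation φ [] :=
  fun k hk => absurd hk (Nat.not_lt_zero k)

/-- An extended-Frege derivation may be extended by a line inferred from its lines or by an
extension axiom with a fresh variable. [Cook–Reckhow 1979, §4, Def. 4.1] [folklore] -/
theorem _root_.Literature.Computability.MetaComplexity.FregeSystem.IsEFDerivation.snoc {φ θ : PropForm ℕ} {π : List (PropForm ℕ)}
    (h : F.IsEFDerivation φ π) (hθ : F.IsInferred π θ ∨ IsExtensionAxiom φ π θ) :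
    F.IsEFDerivation φ (π ++ [θ]) := by
  intro k hk
  rw [List.length_append, List.length_singleton] at hk
  by_cases hk' : k < π.length
  · rw [List.getElem_append_left hk', List.take_append_of_le_length hk'.le]
    exact h k hk'
  · have hkeq : k = π.length := by omega
    have htake : (π ++ [θ]).take k = π := by
      rw [List.take_append_of_le_length (by omega), hkeq, List.take_length]
    rw [List.getElem_concat_length hkeq, htake]
    exact hθ

/-- A prefix of an extended-Frege derivation is an extended-Frege derivation.
[Cook–Reckhow 1979, §4] [folklore] -/
theorem _root_.Literature.Computability.MetaComplexity.FregeSystem.IsEFDerivation.take {φ : PropForm ℕ} {π : List (PropForm ℕ)}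
    (h : F.IsEFDerivation φ π) (n : ℕ) : F.IsEFDerivation φ (π.take n) := by
  intro k hk
  rw [List.length_take] at hk
  have hk' : k < π.length := by omega
  have hkn : k ≤ n := by omega
  rw [List.getElem_take, List.take_take, Nat.min_eq_left hkn]
  exact h k hk'

/-- **Pruning repetitions (extended Frege).** If every line of `L` is inferred from earlier
lines, is an extension axiom (fresh w.r.t. the earlier lines and `φ`), or repeats an earlier
line, then keeping only first occurrences gives an extended-Frege derivation with the same set
of lines and no larger size (inferences and freshness depend on the earlier lines only through
their set). [cite: CookReckhow1979, Thm. 2.3 (proof)] [cite: CookReckhow1979, Def. 4.1] -/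
theorem _root_.Literature.Computability.MetaComplexity.FregeSystem.exists_isEFDerivation_of_relaxed {φ : PropForm ℕ} {L : List (PropForm ℕ)}
    (h : ∀ (k : ℕ) (hk : k < L.length),
      F.IsInferred (L.take k) L[k] ∨ IsExtensionAxiom φ (L.take k) L[k] ∨ L[k] ∈ L.take k) :
    ∃ L' : List (PropForm ℕ), F.IsEFDerivation φ L' ∧ (∀ θ, θ ∈ L' ↔ θ ∈ L) ∧
      proofSize L' ≤ proofSize L := by
  suffices H : ∀ n ≤ L.length, ∃ L' : List (PropForm ℕ), F.IsEFDerivation φ L' ∧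
      (∀ θ, θ ∈ L' ↔ θ ∈ L.take n) ∧ proofSize L' ≤ proofSize (L.take n) by
    simpa using H L.length le_rfl
  intro n
  induction n with
  | zero => exact fun _ => ⟨[], isEFDerivation_nil F φ, by simp, le_rfl⟩
  | succ n ih =>
    intro hn
    obtain ⟨L', hd, hmem, hsize⟩ := ih (Nat.le_of_succ_le hn)
    have hnlt : n < L.length := hn
    rw [List.take_succ_eq_append_getElem hnlt, proofSize_append, proofSize_singleton]
    by_cases hrep : L[n] ∈ L.take n
    · -- a repetition: drop it
      refine ⟨L', hd, fun θ => ?_, hsize.trans (Nat.le_add_right _ _)⟩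
      rw [hmem, List.mem_append, List.mem_singleton]
      exact ⟨Or.inl, fun h' => h'.elim id fun h'' => h'' ▸ hrep⟩
    · -- a new line: keep it
      have hjust : F.IsInferred L' L[n] ∨ IsExtensionAxiom φ L' L[n] := by
        rcases h n hnlt with h₁ | h₂ | h₃
        · exact Or.inl (h₁.mono fun χ hχ => (hmem χ).2 hχ)
        · exact Or.inr (IsExtensionAxiom.of_vars h₂ fun χ hχ v hv => ⟨χ, (hmem χ).1 hχ, hv⟩)
        · exact absurd h₃ hrep
      refine ⟨L' ++ [L[n]], hd.snoc hjust, fun θ => ?_, ?_⟩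
      · simp only [List.mem_append, List.mem_singleton, hmem]
      · rw [proofSize_append, proofSize_singleton]
        exact Nat.add_le_add_right hsize _

/-- Appending to a sequence `L₁` (inferred lines, extension axioms, repetitions) a Frege
derivation `L₂` each of whose hypotheses occurs in `L₁` gives again such a sequence.
[cite: CookReckhow1979, Thm. 2.3 (proof)] -/
theorem _root_.Literature.Computability.MetaComplexity.FregeSystem.relaxedEF_append {φ : PropForm ℕ} {Λ : Set (PropForm ℕ)} {L₁ L₂ : List (PropForm ℕ)}
    (h₁ : ∀ (k : ℕ) (hk : k < L₁.length),
      F.IsInferred (L₁.take k) L₁[k] ∨ IsExtensionAxiom φ (L₁.take k) L₁[k] ∨ L₁[k] ∈ L₁.take k)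
    (h₂ : F.IsDerivation Λ L₂) (hΛ : ∀ θ ∈ Λ, θ ∈ L₁) :
    ∀ (k : ℕ) (hk : k < (L₁ ++ L₂).length),
      F.IsInferred ((L₁ ++ L₂).take k) (L₁ ++ L₂)[k] ∨
        IsExtensionAxiom φ ((L₁ ++ L₂).take k) (L₁ ++ L₂)[k] ∨
        (L₁ ++ L₂)[k] ∈ (L₁ ++ L₂).take k := by
  intro k hk
  by_cases hk₁ : k < L₁.length
  · rw [List.getElem_append_left hk₁, List.take_append_of_le_length hk₁.le]
    exact h₁ k hk₁
  · have hle : L₁.length ≤ k := Nat.le_of_not_lt hk₁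
    have hk₂ : k - L₁.length < L₂.length := by rw [List.length_append] at hk; omega
    rw [List.getElem_append_right hle, List.take_append, List.take_of_length_le hle]
    rcases h₂ (k - L₁.length) hk₂ with hm | hinf
    · exact Or.inr (Or.inr (List.mem_append_left _ (hΛ _ hm)))
    · exact Or.inl (hinf.mono fun χ hχ => List.mem_append_right _ hχ)

/-- Appending an extension axiom (fresh w.r.t. `L₁` and `φ`) to a sequence `L₁` of inferred
lines, extension axioms and repetitions gives again such a sequence.
[cite: CookReckhow1979, Def. 4.1] -/
theorem _root_.Literature.Computability.MetaComplexity.FregeSystem.relaxedEF_append_ext {φ θ : PropForm ℕ} {L₁ : List (PropForm ℕ)}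
    (h₁ : ∀ (k : ℕ) (hk : k < L₁.length),
      F.IsInferred (L₁.take k) L₁[k] ∨ IsExtensionAxiom φ (L₁.take k) L₁[k] ∨ L₁[k] ∈ L₁.take k)
    (hθ : IsExtensionAxiom φ L₁ θ) :
    ∀ (k : ℕ) (hk : k < (L₁ ++ [θ]).length),
      F.IsInferred ((L₁ ++ [θ]).take k) (L₁ ++ [θ])[k] ∨
        IsExtensionAxiom φ ((L₁ ++ [θ]).take k) (L₁ ++ [θ])[k] ∨
        (L₁ ++ [θ])[k] ∈ (L₁ ++ [θ]).take k := by
  intro k hk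
  rw [List.length_append, List.length_singleton] at hk
  by_cases hk' : k < L₁.length
  · rw [List.getElem_append_left hk', List.take_append_of_le_length hk'.le]
    exact h₁ k hk'
  · have hkeq : k = L₁.length := by omega
    have htake : (L₁ ++ [θ]).take k = L₁ := by
      rw [List.take_append_of_le_length (by omega), hkeq, List.take_length]
    rw [List.getElem_concat_length hkeq, htake]
    exact Or.inr (Or.inl hθ)

/-! ### The translation of extended-Frege proofs -/

/-- **One translated line, with its variables.** As `exists_block`, recording moreover that
every variable of the block `σ'(π_R)` occurs in the translated line `θ` or in one of its
premises in `prev` (the extraneous metavariables of `π_R` are sent to `⊤`); this is what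
keeps later extension variables fresh. [cite: CookReckhow1979, Thm. 2.3 (proof)]
[cite: CookReckhow1979, Lemma 2.5] -/
theorem _root_.Literature.Computability.MetaComplexity.FregeSystem.exists_block_vars {B : ℕ}
    (hB : ∀ r ∈ F₂.rules, ∃ D : List (PropForm ℕ),
      F₁.IsDerivation {p | p ∈ r.premises} D ∧ D.getLast? = some r.conclusion ∧
        proofSize D ≤ B)
    {π prev : List (PropForm ℕ)} {θ : PropForm ℕ}
    (hprev : ∀ χ ∈ prev, χ ∈ π) (hθπ : θ ∈ π) (hinf : F₂.IsInferred prev θ) :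
    ∃ blk : List (PropForm ℕ),
      F₁.IsDerivation {χ | χ ∈ prev} blk ∧ θ ∈ blk ∧
        (∀ χ ∈ blk, ∀ v ∈ χ.vars, v ∈ θ.vars ∨ ∃ p ∈ prev, v ∈ p.vars) ∧
        proofSize blk ≤ B * proofSize π := by
  classical
  obtain ⟨r, hr, σ, hc, hp⟩ := hinf
  obtain ⟨D, hD, hlast, hDB⟩ := hB r hr
  -- the (meta)variables of the rule `r`
  set V : Finset ℕ := r.conclusion.vars ∪ (r.premises.map PropForm.vars).foldr (· ∪ ·) ∅
    with hV
  have hVmem : ∀ x, x ∈ V ↔ x ∈ r.conclusion.vars ∨ ∃ p ∈ r.premises, x ∈ p.vars := by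
    intro x
    rw [hV, Finset.mem_union, mem_foldr_union_vars]
  -- `σ'`: `σ` on the variables of `r`, `⊤` on the extraneous variables of `D`
  set σ' : ℕ → PropForm ℕ := fun x => if x ∈ V then σ x else PropForm.const true with hσ'
  have hagree : ∀ q : PropForm ℕ, (∀ x ∈ q.vars, x ∈ V) → q.subst σ' = q.subst σ := by
    intro q hq
    exact PropForm.subst_congr fun x hx => by simp [hσ', hq x hx]
  have hconc : r.conclusion.subst σ' = θ := by
    rw [hagree _ fun x hx => (hVmem x).2 (Or.inl hx), hc]
  have hprem : ∀ p ∈ r.premises, p.subst σ' = p.subst σ := fun p hpm =>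
    hagree _ fun x hx => (hVmem x).2 (Or.inr ⟨p, hpm, hx⟩)
  -- every value of `σ'` is a subformula of a line of `π`, or `⊤`
  have hM1 : 1 ≤ proofSize π := θ.size_pos.trans_le (size_le_proofSize hθπ)
  have hσ'M : ∀ x, (σ' x).size ≤ proofSize π := by
    intro x
    by_cases hx : x ∈ V
    · have hσx : σ' x = σ x := by simp [hσ', hx]
      rw [hσx]
      rcases (hVmem x).1 hx with hxc | ⟨p, hpm, hxp⟩
      · calc (σ x).size ≤ (r.conclusion.subst σ).size := PropForm.size_apply_le_size_subst σ hxc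
          _ ≤ proofSize π := by rw [hc]; exact size_le_proofSize hθπ
      · calc (σ x).size ≤ (p.subst σ).size := PropForm.size_apply_le_size_subst σ hxp
          _ ≤ proofSize π := size_le_proofSize (hprev _ (hp p hpm))
    · have hσx : σ' x = PropForm.const true := by simp [hσ', hx]
      rw [hσx]
      simpa [PropForm.size] using hM1
  refine ⟨D.map (PropForm.subst σ'), (hD.map_subst σ').mono ?_, ?_, ?_, ?_⟩
  · rintro _ ⟨p, hpm, rfl⟩
    show p.subst σ' ∈ prev
    rw [hprem p hpm]
    exact hp p hpm
  · rw [← hconc]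
    exact List.mem_map_of_mem (List.mem_of_getLast? hlast)
  · -- the variables of the block
    intro χ hχ v hv
    obtain ⟨ℓ, _, rfl⟩ := List.mem_map.1 hχ
    obtain ⟨x, _, hvx⟩ := (PropForm.mem_vars_subst σ' ℓ v).1 hv
    by_cases hxV : x ∈ V
    · have hσx : σ' x = σ x := by simp [hσ', hxV]
      rw [hσx] at hvx
      rcases (hVmem x).1 hxV with hxc | ⟨p, hpm, hxp⟩
      · left
        rw [← hc]
        exact (PropForm.mem_vars_subst σ r.conclusion v).2 ⟨x, hxc, hvx⟩
      · right
        exact ⟨p.subst σ, hp p hpm, (PropForm.mem_vars_subst σ p v).2 ⟨x, hxp, hvx⟩⟩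
    · have hσx : σ' x = PropForm.const true := by simp [hσ', hxV]
      rw [hσx] at hvx
      simp [PropForm.vars] at hvx
  · calc proofSize (D.map (PropForm.subst σ'))
        ≤ proofSize D * proofSize π := proofSize_map_subst_le hM1 hσ'M D
      _ ≤ B * proofSize π := Nat.mul_le_mul_right _ hDB

/-- **All lines of an extended-Frege proof translated.** Concatenating the blocks of the first
`n` lines of an extended-Frege derivation `π` (relative to `φ`) over `F₂` — an extension axiom
is its own block and stays an extension axiom, since the variables of the translated prefix
are among those of the original prefix — gives a sequence of size at most
`n · (B · proofSize π + proofSize π)` containing these `n` lines, in which every line is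
`F₁`-inferred from earlier lines, is an extension axiom, or repeats an earlier line.
[Cook–Reckhow 1979, §4 (`e𝓕`, Def. 4.1) with the proof of Thm. 2.3]
[cite: CookReckhow1979, Thm. 2.3 (proof)] [cite: CookReckhow1979, Def. 4.1] -/
theorem _root_.Literature.Computability.MetaComplexity.FregeSystem.exists_translationEF_aux {B : ℕ}
    (hB : ∀ r ∈ F₂.rules, ∃ D : List (PropForm ℕ),
      F₁.IsDerivation {p | p ∈ r.premises} D ∧ D.getLast? = some r.conclusion ∧
        proofSize D ≤ B)
    {φ : PropForm ℕ} {π : List (PropForm ℕ)} (hπ : F₂.IsEFDerivation φ π) :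
    ∀ n ≤ π.length, ∃ L : List (PropForm ℕ),
      (∀ (k : ℕ) (hk : k < L.length),
        F₁.IsInferred (L.take k) L[k] ∨ IsExtensionAxiom φ (L.take k) L[k] ∨ L[k] ∈ L.take k) ∧
      (∀ θ ∈ π.take n, θ ∈ L) ∧
      (∀ χ ∈ L, ∀ v ∈ χ.vars, ∃ θ ∈ π.take n, v ∈ θ.vars) ∧
      proofSize L ≤ n * (B * proofSize π + proofSize π)
  | 0, _ => ⟨[], fun k hk => absurd hk (Nat.not_lt_zero k), by simp, by simp, by simp⟩
  | n + 1, hn => by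
    obtain ⟨L, hL, hmem, hvars, hsize⟩ :=
      exists_translationEF_aux hB hπ n (Nat.le_of_succ_le hn)
    have hnlt : n < π.length := hn
    have hθπ : π[n] ∈ π := List.getElem_mem hnlt
    rw [List.take_succ_eq_append_getElem hnlt]
    -- the block for line `n`
    obtain ⟨blk, hblk, hmemblk, hvarsblk, hsizeblk⟩ : ∃ blk : List (PropForm ℕ),
        (∀ (k : ℕ) (hk : k < (L ++ blk).length),
          F₁.IsInferred ((L ++ blk).take k) (L ++ blk)[k] ∨
            IsExtensionAxiom φ ((L ++ blk).take k) (L ++ blk)[k] ∨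
            (L ++ blk)[k] ∈ (L ++ blk).take k) ∧
        π[n] ∈ blk ∧
        (∀ χ ∈ blk, ∀ v ∈ χ.vars, v ∈ (π[n]).vars ∨ ∃ θ ∈ π.take n, v ∈ θ.vars) ∧
        proofSize blk ≤ B * proofSize π + proofSize π := by
      rcases hπ n hnlt with hinf | hext
      · -- an inferred line is replaced by its block
        obtain ⟨blk, hd, hmemblk, hvb, hsz⟩ :=
          exists_block_vars hB (fun χ hχ => List.mem_of_mem_take hχ) hθπ hinf
        exact ⟨blk, relaxedEF_append hL hd fun θ hθ => hmem θ hθ, hmemblk, hvb,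
          hsz.trans (Nat.le_add_right _ _)⟩
      · -- an extension axiom is kept; it is still fresh
        refine ⟨[π[n]], relaxedEF_append_ext hL (IsExtensionAxiom.of_vars hext hvars),
          List.mem_singleton_self _, fun χ hχ v hv => ?_, ?_⟩
        · rw [List.mem_singleton] at hχ
          subst hχ
          exact Or.inl hv
        · simpa using (size_le_proofSize hθπ).trans (Nat.le_add_left _ _)
    refine ⟨L ++ blk, hblk, fun θ hθ => ?_, fun χ hχ v hv => ?_, ?_⟩
    · rw [List.mem_append, List.mem_singleton] at hθ
      rcases hθ with hθ | rfl
      · exact List.mem_append_left _ (hmem θ hθ)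
      · exact List.mem_append_right _ hmemblk
    · rw [List.mem_append] at hχ
      rcases hχ with hχ | hχ
      · obtain ⟨θ, hθ, hvθ⟩ := hvars χ hχ v hv
        exact ⟨θ, List.mem_append_left _ hθ, hvθ⟩
      · rcases hvarsblk χ hχ v hv with hv' | ⟨θ, hθ, hvθ⟩
        · exact ⟨π[n], List.mem_append_right _ (List.mem_singleton_self _), hv'⟩
        · exact ⟨θ, List.mem_append_left _ hθ, hvθ⟩
    · rw [proofSize_append, Nat.succ_mul]
      exact Nat.add_le_add hsize hsizeblk

/-- **Cook–Reckhow's translation for extended Frege systems over one basis (size form).** If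
`F₁` is implicationally complete and the rules of `F₂` are sound, there is a constant `B` such
that every extended-Frege proof `π` of `φ` over `F₂` can be replaced by an extended-Frege
proof of `φ` over `F₁` of size at most `proofSize π · (B · proofSize π + proofSize π) +
proofSize π`: rule applications are replaced by instances of fixed `F₁`-derivations of the
rules of `F₂` (Thm. 2.3), extension axioms are copied. This is the same-basis case of
Cook–Reckhow's Thm. 4.5 / Cor. 4.7 ("A given extended Frege system is polynomially bounded
if and only if all extended Frege systems over all connective sets are polynomially
bounded"), whose printed proof for different bases goes through Lemmas 4.8–4.11 instead.
[cite: CookReckhow1979, Thm. 2.3] [cite: CookReckhow1979, Thm. 4.5 / Cor. 4.7]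
[cite: Krajicek1995, §4.5 p. 56] -/
theorem _root_.Literature.Computability.MetaComplexity.FregeSystem.exists_translationEF (h₁ : F₁.IsImplicationallyComplete) (h₂ : F₂.IsSound) :
    ∃ B : ℕ, ∀ (π : List (PropForm ℕ)) (φ : PropForm ℕ), F₂.IsEFProofOf π φ →
      ∃ π' : List (PropForm ℕ), F₁.IsEFProofOf π' φ ∧
        proofSize π' ≤ proofSize π * (B * proofSize π + proofSize π) + proofSize π := by
  obtain ⟨B, hB⟩ := exists_ruleDerivations h₁ F₂.rules h₂
  refine ⟨B, fun π φ hπ => ?_⟩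
  obtain ⟨L, hL, hmem, -, hsize⟩ := exists_translationEF_aux hB hπ.1 π.length le_rfl
  rw [List.take_length] at hmem
  obtain ⟨L', hL', hmem', hsize'⟩ := exists_isEFDerivation_of_relaxed hL
  have hφπ : φ ∈ π := List.mem_of_getLast? hπ.2
  obtain ⟨i, hi, hiφ⟩ := List.getElem_of_mem ((hmem' φ).2 (hmem φ hφπ))
  refine ⟨L'.take i ++ [φ], ⟨(hL'.take i).snoc ?_, by simp⟩, ?_⟩
  · have := hL' i hi
    rwa [hiφ] at this
  · rw [proofSize_append, proofSize_singleton]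
    calc proofSize (L'.take i) + φ.size
        ≤ proofSize L + proofSize π :=
          Nat.add_le_add ((proofSize_take_le L' i).trans hsize') (size_le_proofSize hφπ)
      _ ≤ π.length * (B * proofSize π + proofSize π) + proofSize π :=
          Nat.add_le_add_right hsize _
      _ ≤ proofSize π * (B * proofSize π + proofSize π) + proofSize π :=
          Nat.add_le_add_right (Nat.mul_le_mul_right _ (length_le_proofSize π)) _

/-- **Transfer of polynomial boundedness of extended Frege** (the size content of
Cook–Reckhow's Cor. 4.7 over one basis): if `F₁` is implicationally complete, `F₂` is sound
and every tautology `φ` has an extended-Frege proof over `F₂` of size `≤ p(|φ|)`, then it has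
one over `F₁` of size `≤ (p · (B p + p) + p)(|φ|)`. [cite: CookReckhow1979, Thm. 4.5 / Cor. 4.7]
[cite: Krajicek1995, §4.5 p. 56] -/
theorem _root_.Literature.Computability.MetaComplexity.FregeSystem.IsEFPolyBounded.of_isImplicationallyComplete (h₁ : F₁.IsImplicationallyComplete)
    (h₂ : F₂.IsSound) (h : F₂.IsEFPolyBounded) : F₁.IsEFPolyBounded := by
  obtain ⟨B, hB⟩ := exists_translationEF h₁ h₂
  obtain ⟨p, hp⟩ := h
  refine ⟨p * (C B * p + p) + p, fun φ hφ => ?_⟩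
  obtain ⟨π, hπ, hsize⟩ := hp φ hφ
  obtain ⟨π', hπ', hsize'⟩ := hB π φ hπ
  refine ⟨π', hπ', hsize'.trans ?_⟩
  simp only [eval_add, eval_mul, eval_C]
  exact Nat.add_le_add
    (Nat.mul_le_mul hsize (Nat.add_le_add (Nat.mul_le_mul_left _ hsize) hsize)) hsize

end FregeSystem

end Literature.Computability.Complexity

namespace Literature.Computability.Complexity

open MetaComplexity

/-- **Discharge of `efNotPolyBounded_iff_textbookFrege`** (sanity reduction for pnp.S32).
`EFNotPolyBounded` (no Frege system has polynomially bounded extended Frege) is equivalent to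
its instance for the concrete system `textbookFrege`: (→) `textbookFrege` is a Frege system
(`isFrege_textbookFrege_holds`, Shoenfield's completeness theorem); (←) if extended Frege over
some Frege system `F` were polynomially bounded, so would be extended Frege over
`textbookFrege`, by the rule-by-rule translation of Cook–Reckhow's Thm. 2.3 applied to
extended-Frege proofs (extension axioms copied, `FregeSystem.exists_translationEF`), which
needs the implicational completeness of `textbookFrege` and the soundness of `F` — the
same-basis case of Cook–Reckhow 1979, Thm. 4.5 / Cor. 4.7 ("A given extended Frege system is
polynomially bounded if and only if all extended Frege systems over all connective sets are
polynomially bounded"). [cite: CookReckhow1979, Thm. 4.5 / Cor. 4.7]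
[cite: CookReckhow1979, Thm. 2.3] [cite: Krajicek1995, §4.5 p. 56] -/
theorem efNotPolyBounded_iff_textbookFrege_holds : efNotPolyBounded_iff_textbookFrege :=
  ⟨fun h => h textbookFrege isFrege_textbookFrege_holds, fun h _ hF hEF =>
    h (FregeSystem.IsEFPolyBounded.of_isImplicationallyComplete
      isFrege_textbookFrege_holds.2 hF.1 hEF)⟩

end Literature.Computability.Complexity

/-! ## The p-simulation of Frege systems (Cook–Reckhow 1979, Thm. 2.3 / Cor. 2.4): discharge of `frege_pSimulates` -/

namespace Literature.Computability.Complexity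

open _root_.Computability MetaComplexity MetaComplexity.FregeTransl

section PSimulation
open Literature.Computability.MetaComplexity (FregeSystem FregeRule)
open Literature.Computability.MetaComplexity.FregeSystem

variable {F F₁ F₂ : FregeSystem}

/-- A sequence from no hypotheses in which every line is inferred from earlier lines or repeats an
earlier line is a derivation from no hypotheses: the first occurrence of a repeated line is
inferred from an even shorter prefix (`IsInferred.mono`). This is why the translated proof need
not have its repetitions pruned. [Cook–Reckhow 1979, §2, proof of Thm. 2.3 ("with hypotheses
deleted")] [folklore] -/
theorem _root_.Literature.Computability.MetaComplexity.FregeSystem.isDerivation_empty_of_relaxed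
    {L : List (PropForm ℕ)}
    (h : ∀ (k : ℕ) (hk : k < L.length),
      L[k] ∈ (∅ : Set (PropForm ℕ)) ∨ F.IsInferred (L.take k) L[k] ∨ L[k] ∈ L.take k) :
    F.IsDerivation ∅ L := by
  intro k
  induction k using Nat.strong_induction_on with
  | _ k ih =>
    intro hk
    rcases h k hk with h0 | h1 | h2
    · exact absurd h0 (Set.notMem_empty _)
    · exact Or.inr h1
    · right
      obtain ⟨i, hi, hiL⟩ := List.getElem_of_mem h2
      rw [List.length_take] at hi
      have hik : i < k := by omega
      have hiL' : L[i] = L[k] := by rw [List.getElem_take] at hiL; exact hiL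
      rcases ih i hik (by omega) with h0 | hinf
      · exact absurd h0 (Set.notMem_empty _)
      · rw [hiL'] at hinf
        exact hinf.mono fun χ hχ => by
          rw [List.mem_take_iff_getElem] at hχ ⊢
          obtain ⟨j, hj, rfl⟩ := hχ
          exact ⟨j, by omega, rfl⟩

/-- **The translation of a derivation is a derivation** (Cook–Reckhow 1979, Thm. 2.3, for
derivations from no hypotheses). Let `D` assign to every rule `r` of `F₂` an `F₁`-derivation of
`r.conclusion` from `r.premises` ending with `r.conclusion`. Then for every `F₂`-derivation `π`
from `∅`, the translation `translForms D F₂.rules π` — each line `θ` replaced by the block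
`σ'(D r)` of the first rule `r` and tuple of earlier lines of which `θ` is an instance
(`lineForms`) — is a sequence of `F₁`-inferred or repeated lines containing every line of `π`,
and it ends with the last line of `π`. [cite: CookReckhow1979, Thm. 2.3 (proof)]
[cite: CookReckhow1979, Lemma 2.5] -/
theorem _root_.Literature.Computability.MetaComplexity.FregeSystem.translForms_relaxed
    (D : FregeRule → List (PropForm ℕ))
    (hD : ∀ r ∈ F₂.rules, F₁.IsDerivation {p | p ∈ r.premises} (D r) ∧ (D r).getLast? = some r.conclusion)
    {π : List (PropForm ℕ)} (hπ : F₂.IsDerivation ∅ π) :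
    ∀ n ≤ π.length,
      (∀ (k : ℕ) (hk : k < (translForms D F₂.rules (π.take n)).length),
        (translForms D F₂.rules (π.take n))[k] ∈ (∅ : Set (PropForm ℕ)) ∨
          F₁.IsInferred ((translForms D F₂.rules (π.take n)).take k) (translForms D F₂.rules (π.take n))[k] ∨
          (translForms D F₂.rules (π.take n))[k] ∈ (translForms D F₂.rules (π.take n)).take k) ∧
      (∀ θ ∈ π.take n, θ ∈ translForms D F₂.rules (π.take n)) ∧
      (translForms D F₂.rules (π.take n)).getLast? = (π.take n).getLast?
  | 0, _ => by simp
  | n + 1, hn => by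
    obtain ⟨hrel, hmem, -⟩ := translForms_relaxed D hD hπ n (Nat.le_of_succ_le hn)
    have hnlt : n < π.length := hn
    rw [List.take_succ_eq_append_getElem hnlt, translForms_append_singleton]
    -- the current line is inferred in `F₂`, hence its block is `σ'(D r)`
    have hinf : ∃ r ∈ F₂.rules, ∃ σ : ℕ → PropForm ℕ, r.conclusion.subst σ = π[n] ∧
        ∀ p ∈ r.premises, p.subst σ ∈ π.take n := by
      rcases hπ n hnlt with h0 | ⟨r, hr, σ, hc, hp⟩
      · exact absurd h0 (Set.notMem_empty _)
      · exact ⟨r, hr, σ, hc, hp⟩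
    obtain ⟨r, hr, σ, hc, hp, hblk⟩ := lineForms_of_inferred D F₂.rules (π.take n) π[n] hinf
    rw [hblk]
    obtain ⟨hDr, hlast⟩ := hD r hr
    refine ⟨?_, ?_, ?_⟩
    · -- relaxed: append the substituted rule derivation (Lemma 2.5)
      refine relaxed_append hrel (hDr.map_subst σ) ?_
      rintro _ ⟨p, hpm, rfl⟩
      exact Or.inr (hmem _ (hp p hpm))
    · intro θ hθ
      rw [List.mem_append, List.mem_singleton] at hθ
      rcases hθ with hθ | rfl
      · exact List.mem_append_left _ (hmem θ hθ)
      · refine List.mem_append_right _ ?_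
        rw [← hc]
        exact List.mem_map_of_mem (List.mem_of_getLast? hlast)
    · rw [List.getLast?_append, List.getLast?_map, hlast, List.getLast?_append]
      simp [hc]

/-- **Cook–Reckhow 1979, Theorem 2.3 with Corollary 2.4 (p-simulation).** If `F₁` is
implicationally complete and the rules of `F₂` are sound, then `F₁` p-simulates `F₂`: the proof
translation is `translForms D F₂.rules` for a table `D` of `F₁`-derivations of the rules of `F₂`
(`exists_ruleDerivations`); it is polynomial-time computable on Mathlib's `TM2` model with respect
to `encodingPropForm.listBool` (`FregeTransl.polyTimeComputable_translForms`, the machine content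
of "there is a function `f` in `𝓛`"), and it sends `F₂`-proofs of `φ` to `F₁`-proofs of `φ`
(`translForms_relaxed` with `isDerivation_empty_of_relaxed`). [cite: CookReckhow1979, Thm. 2.3]
[cite: CookReckhow1979, Cor. 2.4] -/
theorem _root_.Literature.Computability.MetaComplexity.FregeSystem.pSimulates_of_isImplicationallyComplete
    (h₁ : F₁.IsImplicationallyComplete) (h₂ : F₂.IsSound) : F₁.PSimulates F₂ := by
  classical
  obtain ⟨B, hB⟩ := exists_ruleDerivations h₁ F₂.rules h₂
  -- the table of rule derivations
  let D : FregeRule → List (PropForm ℕ) := fun r =>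
    if h : r ∈ F₂.rules then (hB r h).choose else []
  have hD : ∀ r ∈ F₂.rules, F₁.IsDerivation {p | p ∈ r.premises} (D r) ∧ (D r).getLast? = some r.conclusion := by
    intro r hr
    simp only [D, dif_pos hr]
    exact ⟨(hB r hr).choose_spec.1, (hB r hr).choose_spec.2.1⟩
  refine ⟨translForms D F₂.rules, polyTimeComputable_translForms D F₂.rules, fun π φ hπφ => ?_⟩
  obtain ⟨hπ, hlastπ⟩ := hπφ
  obtain ⟨hrel, -, hlast⟩ := FregeSystem.translForms_relaxed D hD hπ π.length le_rfl
  rw [List.take_length] at hrel hlast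
  exact ⟨isDerivation_empty_of_relaxed hrel, hlast.trans hlastπ⟩

end PSimulation

/-- **Discharge of `frege_pSimulates`** (pnp.S30(b); Cook–Reckhow 1979, Cor. 2.4: "Any two Frege
systems over `κ` p-simulate each other"): for Frege systems `F₁`, `F₂` over the fixed basis of
`PropForm`, `F₁` p-simulates `F₂` — by `FregeSystem.pSimulates_of_isImplicationallyComplete`,
which uses the implicational completeness of `F₁` and the soundness of `F₂` (Thm. 2.3: the
rule-by-rule translation `translForms`, proved polynomial-time on `TM2` in
`Literature/Computability/MetaComplexity/FregeTranslation.lean`). [cite: CookReckhow1979, Cor. 2.4]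
[cite: CookReckhow1979, Thm. 2.3] [cite: Krajicek1995, Thm 4.4.13] -/
theorem frege_pSimulates_holds : frege_pSimulates :=
  fun _ _ h₁ h₂ => FregeSystem.pSimulates_of_isImplicationallyComplete h₁.2 h₂.1

end Literature.Computability.Complexity
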